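/-
Copyright (c) 2026 the pub-hodgecm-mathlib formalisation cell (harness21).  Prover seat hodgecm-mathlib-LH4-p07 (g0): unit U2H_HSide of the «(D-RAM) FOUR-FRAME» road,
TIER-2 helper file №1 of 2 towards the stub `stub_U2H_stableOI_hProfiles_typeOne_wild` of `Cruxes/H413/Lines/F0_P3c_DyRamFourFrame_U2H_HSide.lean` (ED. 3, §1b)
(heir LEAD F0P3a-plan (g19) «FOUR-FRAME SKELETON LANDED» EMIT LIST #4; dealer LH4-plan (g10)).  2026-09-03.
-/
import Summits.HodgeConjecture.HodgeConjecture.Theorems.F0P3cDyRamFourFrameHFamilyDefs          -- DEFS LEAF №5 (LH4-p03): `hProfileZero`, `hProfileSharp`, `hFamily`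
import Literature.NumberTheory.Rogawski1990.LocalStableClassesNonsplit                        -- ★ `twistGram_eigenframe_eq_diagonal` (the eigenlines of a unitary element are orthogonal)
import Literature.NumberTheory.Rogawski1990.RankOneKappaOrbitalDepthExpansionH                -- ★ `coe_localNonsplitEquiv_mul_map_eq` (frames read at `w`)
import Literature.NumberTheory.Rogawski1990.FinExplicitTransferFactorInertPlaceValuation      -- ★ `valued_apply_eq_one_of_conjLocal_mul_self`
import Literature.NumberTheory.Automorphic.UnitaryTwoRamifiedTreeStabilizers                   -- ★ `coe_mem_glInt_iff_forall_v_le_one` (`K₂` by entries: `|det| = 1` on `U_w`)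
import Literature.NumberTheory.Automorphic.LocalUnitaryIntegralLevel                           -- ★ `mem_localIntegralLevel_iff_of_smul_eq`, `isUnit_placeForm_antidiagOne`
import Literature.NumberTheory.Automorphic.UnitOrbitalIntegralFixedPointsPair                  -- ★ `cmLocalIntegralLevel_one_eq_top_of_smul_eq` (`U(Φ₁)(𝒪_v) = U(Φ₁)(L⁺_v)`)
import HarnessLib

/-!
# Crux `H413`, line LH4 «(D-RAM) FOUR-FRAME» — unit U2H_HSide (ii-H), TIER 2, helper №1: the two H-side profiles `1_{K_H}`, `1_{K♯ × U₁}` read an elliptic type-(1) element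
# of `H_v` only through its EIGENFRAME and its DEPTH `|d₀ − d₁|_w` (frame algebra; re-eigenvaluing a torus element)

Cell `hodgecm-mathlib` (D-0151), FLOOR 0, crux item H413 = `stmt-HodgeConjecture-24833`, route of record `HCCMUnconditional`; squad F0∕P3c∕LH4; tier-1 module
`Cruxes/H413/Lines/F0_P3c_DyRamFourFrame_U2H_HSide.lean` ED. 3, §1b stub `stub_U2H_stableOI_hProfiles_typeOne_wild` (desk row `stableOI_H_edgeBall`) — this is helper №1 of the
two files paying it (№2 = `Theorems/F0P3cDyRamU2HStableOIHProfilesTypeOneWild.lean`, the stub TOKEN FOR TOKEN).  THEOREMS ONLY (no `def`, no instance, no notation, no named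
fact, no `sorry`, default heartbeats); lane `--supports stmt-HodgeConjecture-24833` (count-neutral).

THE MATHEMATICS ([Rogawski1990] §3.5–§3.6, [Serre1980Trees] II §1.1).  Let `K` be a field with involution `σ`, `γ ∈ U(σ, H)(K)` with an eigenframe `γ P = P · diag(u)`, `u`
injective of norm one (`σ(uᵢ) uᵢ = 1`): a TYPE-(1) torus element.
* §1 FRAME ALGEBRA.  `(Q · diag(d) · Q⁻¹)ᵢⱼ = d₁ δᵢⱼ + (d₀ − d₁) · Qᵢ₀ (Q⁻¹)₀ⱼ` (`2 × 2`, `conj_diagonal_apply_two`); two elements diagonalised by the same frame commute; a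
  conjugate `y g y⁻¹` is framed by `y Q`; and **RE-EIGENVALUING** (`conj_glDiagonal_mem_unitaryGroupOfForm_of_eigenframe`): the Gram matrix `H_P = ᵗ(σP) H P` is DIAGONAL
  (★ `twistGram_eigenframe_eq_diagonal`), so `P · diag(d) · P⁻¹ ∈ U(σ, H)(K)` for EVERY norm-one `d` — the torus `Z(γ) ≅ (E¹)ⁿ` in its orthogonal frame.
* §2 THE DEPTH CRITERION (valued field).  With `|d₁| ≤ 1`: `|d₁ + (d₀ − d₁) m| ≤ 1 ↔ |d₀ − d₁|·|m| ≤ 1`; hence for weights `c` with `c_{aa} = 1` the family of entry tests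
  `|c_{ab} (Q diag(d) Q⁻¹)_{ab}| ≤ 1` depends on `d` only through the depth `|d₀ − d₁|` (`forall_valued_mul_conj_diagonal_le_one_iff`).
* §3 AT A NON-SPLIT CM PLACE `w ∣ v` (`H_v = U(Φ₂)(L⁺_v) × U(Φ₁)(L⁺_v)`): the one-place matrix of a framed `g₂` is `Q_w diag(d_w) Q_w⁻¹` (★ `coe_localNonsplitEquiv_mul_map_eq`);
  `1_{K_H}(g)` is the test «all entries of `g_{2,w}` integral» (`K_H = K₂ × U(Φ₁)_v`, ★ `cmLocalIntegralLevel_one_eq_top_of_smul_eq`, ★ `mem_localIntegralLevel_iff_of_smul_eq`,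
  ★ `coe_mem_glInt_iff_forall_v_le_one`), `1_{K♯ × U₁}(g)` (DEFS LEAF №5 `hProfileSharp`) is the test with weights `ϖ^b ϖ^{−a}` — so BOTH PROFILES TAKE THE SAME VALUE at two
  elements framed by the same `Q` with norm-one data of the same depth (`hProfileZero_eq_of_frame`, `hProfileSharp_eq_of_frame`).  This is the pointwise input of the
  stable-invariance argument of helper №2 (there: `Φ^st(γ_H, hFamily s)` depends on the depth only).

HONEST LABEL.  Count-neutral; the verdict of record for (D-RAM) stays PRINT [LanglandsShelstad1989 Thm. p. 484 ∕ Rogawski1990 Prop. 4.9.1 (a)] ∕ XL; `HC_CM` is proved only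
modulo the 7 printed citations (2 remaining: hLiu418 = `stmt-HodgeConjecture-24832`, h413 = `stmt-HodgeConjecture-24833`) until rung 0 closes.

## References
* [Rogawski1990] J. D. Rogawski, *Automorphic Representations of Unitary Groups in Three Variables*, Ann. of Math. Stud. 123 (1990): §3.5 Prop. 3.5.2 p. 29, §3.6 p. 31
  (type-(1) tori and their frames), §4.9 p. 54 and Lemma 4.9.3 p. 56 (the H-side test functions).
* [Serre1980Trees] J.-P. Serre, *Trees* (1980), Ch. II §1.1 (lattice stabilisers in `GL₂` by entries).
-/

noncomputable section

namespace Summit.HodgeConjecture.HodgeConjecture.Cruxes.H413.F0P3cDyRamHProfilesFrameDepth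

open MeasureTheory Measure NumberField IsDedekindDomain Topology Filter Matrix
open Literature.NumberTheory.Automorphic Literature.NumberTheory.Automorphic.UnitaryGroup Literature.NumberTheory.Automorphic.IntegralReduction
open Literature.NumberTheory.Rogawski1990 Literature.NumberTheory.GaloisRepresentations
open Summit.HodgeConjecture.HodgeConjecture.Cruxes.H413.F0P3cDyRamFourFrameHSideDefs
open Summit.HodgeConjecture.HodgeConjecture.Cruxes.H413.F0P3cDyRamFourFrameHFamilyDefs
open scoped Matrix MatrixGroups Classical ValuativeRel WithZero

/-! ## §1  Frame algebra over a commutative ring ∕ a field -/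

section Algebra

variable {R : Type*} [CommRing R]

/-- **Entries of an element in its eigenframe** (`2 × 2`): `(Q · diag(d) · Q⁻¹)ᵢⱼ = d₁ δᵢⱼ + (d₀ − d₁) · Qᵢ₀ (Q⁻¹)₀ⱼ` — the scalar `d₁` plus `(d₀ − d₁)` times the projector
`Q e₁₁ Q⁻¹` onto the first eigenline. [cite: Rogawski1990, §3.6 p. 31] -/
theorem conj_diagonal_apply_two (Q : GL (Fin 2) R) (d : Fin 2 → R) (i j : Fin 2) :
    (Q.val * diagonal d * (Q⁻¹).val) i j = d 1 * (1 : Matrix (Fin 2) (Fin 2) R) i j + (d 0 - d 1) * (Q.val i 0 * (Q⁻¹).val 0 j) := by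
  have h1 : Q.val i 0 * (Q⁻¹).val 0 j + Q.val i 1 * (Q⁻¹).val 1 j = (1 : Matrix (Fin 2) (Fin 2) R) i j := by
    have h := congrFun (congrFun (Units.mul_inv Q) i) j
    rwa [Matrix.mul_apply, Fin.sum_univ_two] at h
  rw [Matrix.mul_apply, Fin.sum_univ_two, Matrix.mul_diagonal, Matrix.mul_diagonal]
  linear_combination (d 1) * h1

variable {n : Type*} [Fintype n] [DecidableEq n]

/-- Two elements diagonalised by the same frame commute. [cite: Rogawski1990, §3.6 p. 31] -/
theorem conj_diagonal_mul_comm (P : GL n R) (a b : n → R) :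
    P.val * diagonal a * (P⁻¹).val * (P.val * diagonal b * (P⁻¹).val) = P.val * diagonal b * (P⁻¹).val * (P.val * diagonal a * (P⁻¹).val) := by
  have e : ∀ X : Matrix n n R, (P⁻¹).val * (P.val * X) = X := fun X => by rw [← Matrix.mul_assoc, Units.inv_mul, Matrix.one_mul]
  have h : ∀ a b : n → R, P.val * diagonal a * (P⁻¹).val * (P.val * diagonal b * (P⁻¹).val) = P.val * (diagonal fun i => a i * b i) * (P⁻¹).val :=
    fun a b => by rw [← diagonal_mul_diagonal]; simp only [Matrix.mul_assoc, e]
  rw [h, h, show (fun i => a i * b i) = (fun i => b i * a i) from funext fun i => mul_comm _ _]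

/-- Conjugating a framed element conjugates its frame: `g Q = Q D ⇒ (y g y⁻¹) (y Q) = (y Q) D`. [cite: Rogawski1990, §3.6 p. 31] -/
theorem conj_mul_frame_eq (y G : GL n R) {D : Matrix n n R} {Q : GL n R} (h : G.val * Q.val = Q.val * D) :
    (y * G * y⁻¹).val * (y * Q).val = (y * Q).val * D := by
  rw [Units.val_mul, Units.val_mul, Units.val_mul, show y.val * G.val * (y⁻¹).val * (y.val * Q.val) = y.val * (G.val * Q.val) by
    simp only [Matrix.mul_assoc]; rw [← Matrix.mul_assoc (y⁻¹).val, Units.inv_mul, Matrix.one_mul], h, Matrix.mul_assoc]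

/-- If `x ∈ S ↔ y ∈ S` then `1_S x = 1_S y`. [cite: Rogawski1990, §4.9 p. 54] -/
theorem indicator_one_eq_of_iff {X : Type*} {S : Set X} {x y : X} (h : x ∈ S ↔ y ∈ S) :
    S.indicator (fun _ => (1 : ℂ)) x = S.indicator (fun _ => (1 : ℂ)) y := by
  by_cases hx : x ∈ S
  · rw [Set.indicator_of_mem hx, Set.indicator_of_mem (h.1 hx)]
  · rw [Set.indicator_of_notMem hx, Set.indicator_of_notMem (fun hy => hx (h.2 hy))]

end Algebra

section Unitary

variable {K : Type*} [Field K] {n : ℕ}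

/-- **RE-EIGENVALUING A TYPE-(1) TORUS ELEMENT.**  If `γ ∈ U(σ, H)(K)` has the eigenframe `γ P = P · diag(u)` with `u` injective and of norm one — so that the Gram matrix
`H_P = ᵗ(σP) H P` is DIAGONAL (★ `twistGram_eigenframe_eq_diagonal`: the eigenlines are `H`-orthogonal) — then for ANY norm-one diagonal data `d` the element `P · diag(d) · P⁻¹`
is again in `U(σ, H)(K)`: `ᵗσ(diag d) · H_P · diag d = H_P`.  (The torus `Z(γ) ≅ (E¹)ⁿ` written in its orthogonal frame.) [cite: Rogawski1990, §3.6 p. 31; §3.5 p. 29] -/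
theorem conj_glDiagonal_mem_unitaryGroupOfForm_of_eigenframe (σ : K →+* K) (H : Matrix (Fin n) (Fin n) K)
    {γ : GL (Fin n) K} (hγ : γ ∈ unitaryGroupOfForm σ H) {P : GL (Fin n) K} {u : Fin n → K}
    (hP : γ.val * P.val = P.val * diagonal u) (hu : Function.Injective u) (hu1 : ∀ i, σ (u i) * u i = 1)
    (d : Fin n → Kˣ) (hd1 : ∀ i, σ (d i : K) * d i = 1) :
    P * glDiagonal n K d * P⁻¹ ∈ unitaryGroupOfForm σ H := by
  have hγ' : γ ∈ Literature.AlgebraicGeometry.ShimuraVarieties.unitaryGroup σ H := hγ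
  have hG := twistGram_eigenframe_eq_diagonal σ H hγ' hP hu hu1
  rw [mem_unitaryGroupOfForm_iff, ← twistGram_def, Units.val_mul, Units.val_mul, coe_glDiagonal, twistGram_mul, twistGram_mul, hG, diagonal_map (map_zero σ),
    diagonal_transpose, diagonal_mul_diagonal, diagonal_mul_diagonal]
  have hdiag : (diagonal fun i => σ (d i : K) * twistGram σ H P.val i i * (d i : K)) = twistGram σ H P.val := by
    conv_rhs => rw [hG]
    congr 1
    funext i
    rw [mul_right_comm, hd1 i, one_mul]
  rw [hdiag, ← twistGram_mul, Units.mul_inv, twistGram_one]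

end Unitary

/-! ## §2  The depth criterion in a frame (valued field) -/

section Valuation

variable {K : Type*} [Field K] [Valued K ℤᵐ⁰]

/-- Diagonal-entry criterion: for `|d₁| ≤ 1`, `|d₁ + (d₀ − d₁) m| ≤ 1 ↔ |d₀ − d₁|·|m| ≤ 1` (ultrametric, both directions). [cite: Serre1980Trees, Ch. II §1.1] -/
theorem valued_add_sub_mul_le_one_iff {d₀ d₁ m : K} (h1 : Valued.v d₁ ≤ 1) :
    Valued.v (d₁ + (d₀ - d₁) * m) ≤ 1 ↔ Valued.v (d₀ - d₁) * Valued.v m ≤ 1 := by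
  rw [← map_mul]
  constructor
  · intro h
    have e : (d₀ - d₁) * m = (d₁ + (d₀ - d₁) * m) - d₁ := by ring
    rw [e]
    exact le_trans (Valuation.map_sub _ _ _) (max_le h h1)
  · intro h
    exact le_trans (Valuation.map_add _ _ _) (max_le h1 h)

/-- **THE DEPTH CRITERION IN A FRAME.**  For a frame `Q ∈ GL₂(K)`, weights `c` with `c_{aa} = 1`, and two diagonal data `d, d′` with `|d₁|, |d′₁| ≤ 1` of THE SAME DEPTH
`|d₀ − d₁| = |d′₀ − d′₁|`: the weighted entries of `Q diag(d) Q⁻¹` are all integral iff those of `Q diag(d′) Q⁻¹` are (entry formula `conj_diagonal_apply_two`; off the diagonal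
the valuation is multiplicative, on it `valued_add_sub_mul_le_one_iff`). [cite: Serre1980Trees, Ch. II §1.1] [cite: Rogawski1990, §3.6 p. 31] -/
theorem forall_valued_mul_conj_diagonal_le_one_iff (Q : GL (Fin 2) K) (c : Fin 2 → Fin 2 → K) (hc : ∀ a, c a a = 1)
    {d d' : Fin 2 → K} (hd : Valued.v (d 1) ≤ 1) (hd' : Valued.v (d' 1) ≤ 1) (hN : Valued.v (d 0 - d 1) = Valued.v (d' 0 - d' 1)) :
    (∀ a b, Valued.v (c a b * (Q.val * diagonal d * (Q⁻¹).val) a b) ≤ 1) ↔ (∀ a b, Valued.v (c a b * (Q.val * diagonal d' * (Q⁻¹).val) a b) ≤ 1) := by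
  refine forall_congr' fun a => forall_congr' fun b => ?_
  rw [conj_diagonal_apply_two, conj_diagonal_apply_two]
  by_cases hab : a = b
  · subst hab
    simp only [hc, one_mul, Matrix.one_apply_eq, mul_one]
    rw [valued_add_sub_mul_le_one_iff hd, valued_add_sub_mul_le_one_iff hd', hN]
  · simp only [Matrix.one_apply_ne hab, mul_zero, zero_add, map_mul, hN]

/-- The depth criterion with unit weights: all entries of `Q diag(d) Q⁻¹` are integral iff all entries of `Q diag(d′) Q⁻¹` are, for norm-one data of the same depth.
[cite: Serre1980Trees, Ch. II §1.1] -/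
theorem forall_valued_conj_diagonal_le_one_iff (Q : GL (Fin 2) K)
    {d d' : Fin 2 → K} (hd : Valued.v (d 1) ≤ 1) (hd' : Valued.v (d' 1) ≤ 1) (hN : Valued.v (d 0 - d 1) = Valued.v (d' 0 - d' 1)) :
    (∀ a b, Valued.v ((Q.val * diagonal d * (Q⁻¹).val) a b) ≤ 1) ↔ (∀ a b, Valued.v ((Q.val * diagonal d' * (Q⁻¹).val) a b) ≤ 1) := by
  have h := forall_valued_mul_conj_diagonal_le_one_iff Q (fun _ _ => (1 : K)) (fun _ => rfl) hd hd' hN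
  simpa only [one_mul] using h

end Valuation

/-! ## §3  At a non-split CM place: the two profiles of `hFamily` see an elliptic type-(1) element only through (frame, depth) -/

section Place

variable (L : Type) [Field L] [NumberField L] [IsCMField L] {v : HeightOneSpectrum (𝓞 ↥(maximalRealSubfield L))}
  (w : PlacesOver L v) (hw : IsCMField.complexConj L • w.1 = w.1)

/-- **Frames read at `w`**: if `g Q = Q · diag(d)` over `E_v` then the one-place matrix of `g` is `Q_w · diag(d_w) · Q_w⁻¹` (★ `coe_localNonsplitEquiv_mul_map_eq`).
[cite: Rogawski1990, §3.6 p. 31] -/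
theorem coe_localNonsplitEquiv_eq_conj_diagonal (g : ((cmDatum L 2 (Matrix.of fun i j : Fin 2 => if i.val + j.val + 1 = 2 then (1 : L) else 0)).Local v)) (Q : GL (Fin 2) (LocalRing L v)) (d : Fin 2 → LocalRing L v)
    (hQ : (g.val.val : Matrix (Fin 2) (Fin 2) (LocalRing L v)) * Q.val = Q.val * diagonal d) :
    (((localNonsplitEquiv (IsCMField.complexConj L) (Matrix.of fun i j : Fin 2 => if i.val + j.val + 1 = 2 then (1 : L) else 0) (IsCMField.complexConj_ne_one L) w hw g : ↥(unitaryGroupOfForm (galAdicCompletionMap (L := L) (IsCMField.complexConj L) hw) (placeForm (Matrix.of fun i j : Fin 2 => if i.val + j.val + 1 = 2 then (1 : L) else 0) w.1))) : GL (Fin 2) (w.1.adicCompletion L)) :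
        Matrix (Fin 2) (Fin 2) (w.1.adicCompletion L)) =
      (Matrix.GeneralLinearGroup.map (Pi.evalRingHom (fun w' : PlacesOver L v => w'.1.adicCompletion L) w) Q).val * diagonal (fun i => d i w) *
        ((Matrix.GeneralLinearGroup.map (Pi.evalRingHom (fun w' : PlacesOver L v => w'.1.adicCompletion L) w) Q)⁻¹).val := by
  have h := coe_localNonsplitEquiv_mul_map_eq L v w hw g Q (diagonal d) hQ
  rw [diagonal_map (map_zero _)] at h
  simp only [Pi.evalRingHom_apply] at h
  rw [← h, Matrix.mul_assoc, Units.mul_inv, Matrix.mul_one]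

include hw in
/-- **`1_{K_H}` SEES ONLY (FRAME, DEPTH).**  If `g, g′ ∈ H_v` have `U(Φ₂)`-parts framed by the SAME `Q` with norm-one diagonal data `d`, `d′` of the same depth
`|d₀ − d₁|_w = |d′₀ − d′₁|_w`, then `hProfileZero L v g = hProfileZero L v g′`: `K_H = K₂ × U(Φ₁)_v` at a non-split place (★ `cmLocalIntegralLevel_one_eq_top_of_smul_eq`),
`g₂ ∈ K₂ ↔` all entries of `g_{2,w}` are integral (★ `mem_localIntegralLevel_iff_of_smul_eq`, ★ `coe_mem_glInt_iff_forall_v_le_one`), and §2. [cite: Rogawski1990, §4.9 Lemma 4.9.3 p. 56; §3.6 p. 31]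
[cite: Serre1980Trees, Ch. II §1.1] -/
theorem hProfileZero_eq_of_frame (g g' : ((cmDatum L 2 (Matrix.of fun i j : Fin 2 => if i.val + j.val + 1 = 2 then (1 : L) else 0)).Local v × (cmDatum L 1 (Matrix.of fun i j : Fin 1 => if i.val + j.val + 1 = 1 then (1 : L) else 0)).Local v)) (Q : GL (Fin 2) (LocalRing L v)) (d d' : Fin 2 → LocalRing L v)
    (hQ : (g.1.val.val : Matrix (Fin 2) (Fin 2) (LocalRing L v)) * Q.val = Q.val * diagonal d)
    (hQ' : (g'.1.val.val : Matrix (Fin 2) (Fin 2) (LocalRing L v)) * Q.val = Q.val * diagonal d')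
    (hd : ∀ i, conjLocal L (IsCMField.complexConj L) v (d i) * d i = 1) (hd' : ∀ i, conjLocal L (IsCMField.complexConj L) v (d' i) * d' i = 1)
    (hN : Valued.v (d 0 w - d 1 w) = Valued.v (d' 0 w - d' 1 w)) :
    hProfileZero L v g = hProfileZero L v g' := by
  have hc1 : IsCMField.complexConj L ≠ 1 := IsCMField.complexConj_ne_one L
  haveI : Algebra.IsQuadraticExtension ↥(maximalRealSubfield L) L := IsCMField.isQuadraticExtension L
  have hK1 : cmLocalIntegralLevel L 1 (Matrix.of fun i j : Fin 1 => if i.val + j.val + 1 = 1 then (1 : L) else 0) v = ⊤ := cmLocalIntegralLevel_one_eq_top_of_smul_eq L _ w hw (isUnit_placeForm_antidiagOne (E := L) 1 w.1)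
  have hv1 : Valued.v (d 1 w) = 1 := valued_apply_eq_one_of_conjLocal_mul_self L v w hw (hd 1)
  have hv1' : Valued.v (d' 1 w) = 1 := valued_apply_eq_one_of_conjLocal_mul_self L v w hw (hd' 1)
  -- membership in `K_H = K₂ × K₁` read on the entries of the one-place matrix `Q_w diag(e_w) Q_w⁻¹`
  have hmem : ∀ (h : ((cmDatum L 2 (Matrix.of fun i j : Fin 2 => if i.val + j.val + 1 = 2 then (1 : L) else 0)).Local v × (cmDatum L 1 (Matrix.of fun i j : Fin 1 => if i.val + j.val + 1 = 1 then (1 : L) else 0)).Local v)) (e : Fin 2 → LocalRing L v), (h.1.val.val : Matrix (Fin 2) (Fin 2) (LocalRing L v)) * Q.val = Q.val * diagonal e →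
      (h ∈ ((((cmLocalIntegralLevel L 2 (Matrix.of fun i j : Fin 2 => if i.val + j.val + 1 = 2 then (1 : L) else 0) v).prod (cmLocalIntegralLevel L 1 (Matrix.of fun i j : Fin 1 => if i.val + j.val + 1 = 1 then (1 : L) else 0) v) : Subgroup ((cmDatum L 2 (Matrix.of fun i j : Fin 2 => if i.val + j.val + 1 = 2 then (1 : L) else 0)).Local v × (cmDatum L 1 (Matrix.of fun i j : Fin 1 => if i.val + j.val + 1 = 1 then (1 : L) else 0)).Local v))) : Set ((cmDatum L 2 (Matrix.of fun i j : Fin 2 => if i.val + j.val + 1 = 2 then (1 : L) else 0)).Local v × (cmDatum L 1 (Matrix.of fun i j : Fin 1 => if i.val + j.val + 1 = 1 then (1 : L) else 0)).Local v)) ↔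
        ∀ a b, Valued.v (((Matrix.GeneralLinearGroup.map (Pi.evalRingHom (fun w' : PlacesOver L v => w'.1.adicCompletion L) w) Q).val *
          diagonal (fun i => e i w) * ((Matrix.GeneralLinearGroup.map (Pi.evalRingHom (fun w' : PlacesOver L v => w'.1.adicCompletion L) w) Q)⁻¹).val) a b) ≤ 1) := by
    intro h e he
    have h1 : h ∈ ((((cmLocalIntegralLevel L 2 (Matrix.of fun i j : Fin 2 => if i.val + j.val + 1 = 2 then (1 : L) else 0) v).prod (cmLocalIntegralLevel L 1 (Matrix.of fun i j : Fin 1 => if i.val + j.val + 1 = 1 then (1 : L) else 0) v) : Subgroup ((cmDatum L 2 (Matrix.of fun i j : Fin 2 => if i.val + j.val + 1 = 2 then (1 : L) else 0)).Local v × (cmDatum L 1 (Matrix.of fun i j : Fin 1 => if i.val + j.val + 1 = 1 then (1 : L) else 0)).Local v))) : Set ((cmDatum L 2 (Matrix.of fun i j : Fin 2 => if i.val + j.val + 1 = 2 then (1 : L) else 0)).Local v × (cmDatum L 1 (Matrix.of fun i j : Fin 1 => if i.val + j.val + 1 = 1 then (1 : L) else 0)).Local v)) ↔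
        h.1 ∈ cmLocalIntegralLevel L 2 (Matrix.of fun i j : Fin 2 => if i.val + j.val + 1 = 2 then (1 : L) else 0) v ∧ h.2 ∈ cmLocalIntegralLevel L 1 (Matrix.of fun i j : Fin 1 => if i.val + j.val + 1 = 1 then (1 : L) else 0) v := SetLike.mem_coe.trans Subgroup.mem_prod
    have h2 : h.2 ∈ cmLocalIntegralLevel L 1 (Matrix.of fun i j : Fin 1 => if i.val + j.val + 1 = 1 then (1 : L) else 0) v := by rw [hK1]; exact Subgroup.mem_top _
    have h3 := mem_localIntegralLevel_iff_of_smul_eq (IsCMField.complexConj L) 2 (Matrix.of fun i j : Fin 2 => if i.val + j.val + 1 = 2 then (1 : L) else 0) hc1 w hw h.1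
    have h4 := coe_mem_glInt_iff_forall_v_le_one L w hw
      (localNonsplitEquiv (IsCMField.complexConj L) (Matrix.of fun i j : Fin 2 => if i.val + j.val + 1 = 2 then (1 : L) else 0) hc1 w hw h.1)
    rw [coe_localNonsplitEquiv_eq_conj_diagonal L w hw h.1 Q e he] at h4
    exact h1.trans ⟨fun hh => h4.1 (h3.1 hh.1), fun hh => ⟨h3.2 (h4.2 hh), h2⟩⟩
  unfold hProfileZero
  exact indicator_one_eq_of_iff ((hmem g d hQ).trans
    ((forall_valued_conj_diagonal_le_one_iff (Matrix.GeneralLinearGroup.map (Pi.evalRingHom (fun w' : PlacesOver L v => w'.1.adicCompletion L) w) Q)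
      (d := fun i => d i w) (d' := fun i => d' i w) hv1.le hv1'.le hN).trans (hmem g' d' hQ').symm))

/-- **`1_{K♯ × U₁}` SEES ONLY (FRAME, DEPTH).**  Same as `hProfileZero_eq_of_frame` for the `ϖ`-modular profile `hProfileSharp L w hw ϖ` (`ϖ ≠ 0`): its set-builder tests
`|ϖ^b ϖ^{−a} (g_{2,w})_{ab}|_w ≤ 1` have diagonal weights `ϖ^a ϖ^{−a} = 1`, so §2 applies. [cite: Rogawski1990, §4.9 Lemma 4.9.3 p. 56; §3.6 p. 31] [cite: Serre1980Trees, Ch. II §1.1] -/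
theorem hProfileSharp_eq_of_frame {ϖ : w.1.adicCompletion L} (hϖ0 : ϖ ≠ 0) (g g' : ((cmDatum L 2 (Matrix.of fun i j : Fin 2 => if i.val + j.val + 1 = 2 then (1 : L) else 0)).Local v × (cmDatum L 1 (Matrix.of fun i j : Fin 1 => if i.val + j.val + 1 = 1 then (1 : L) else 0)).Local v)) (Q : GL (Fin 2) (LocalRing L v)) (d d' : Fin 2 → LocalRing L v)
    (hQ : (g.1.val.val : Matrix (Fin 2) (Fin 2) (LocalRing L v)) * Q.val = Q.val * diagonal d)
    (hQ' : (g'.1.val.val : Matrix (Fin 2) (Fin 2) (LocalRing L v)) * Q.val = Q.val * diagonal d')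
    (hd : ∀ i, conjLocal L (IsCMField.complexConj L) v (d i) * d i = 1) (hd' : ∀ i, conjLocal L (IsCMField.complexConj L) v (d' i) * d' i = 1)
    (hN : Valued.v (d 0 w - d 1 w) = Valued.v (d' 0 w - d' 1 w)) :
    hProfileSharp L w hw ϖ g = hProfileSharp L w hw ϖ g' := by
  have hv1 : Valued.v (d 1 w) = 1 := valued_apply_eq_one_of_conjLocal_mul_self L v w hw (hd 1)
  have hv1' : Valued.v (d' 1 w) = 1 := valued_apply_eq_one_of_conjLocal_mul_self L v w hw (hd' 1)
  have key := forall_valued_mul_conj_diagonal_le_one_iff (Matrix.GeneralLinearGroup.map (Pi.evalRingHom (fun w' : PlacesOver L v => w'.1.adicCompletion L) w) Q)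
    (fun a b : Fin 2 => ϖ ^ (b : ℕ) * (ϖ ^ (a : ℕ))⁻¹) (fun a => mul_inv_cancel₀ (pow_ne_zero _ hϖ0)) (d := fun i => d i w) (d' := fun i => d' i w)
    hv1.le hv1'.le hN
  unfold hProfileSharp
  apply indicator_one_eq_of_iff
  simp only [Set.mem_setOf_eq]
  rw [coe_localNonsplitEquiv_eq_conj_diagonal L w hw g.1 Q d hQ, coe_localNonsplitEquiv_eq_conj_diagonal L w hw g'.1 Q d' hQ']
  exact key

end Place

end Summit.HodgeConjecture.HodgeConjecture.Cruxes.H413.F0P3cDyRamHProfilesFrameDepth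

end
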